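import Literature.Geometry.Lorentzian.KerrDataSchwarzschildMetric
import Literature.Geometry.Lorentzian.WeightedNorms
import Mathlib.MeasureTheory.Measure.Lebesgue.EqHaar

/-!
# `CaptureSuffices` (crux `stmt-FinalStateConjecture-9953`, route `PhaseMixingCapture`):
# Kerr mass pinning in the weighted Sobolev basins with `δ ≥ 0`

Negative-side support file of the crux disprover (cdisprove seat); companion of
`AdversarialWitnesses.lean`, whose `nearExtremalKappaCapture_iff_sharp` / `bulkKerrCapture_iff_sharp`
(threshold `δ₀ = 0`) show that a prover of the crux may only rely on capture basins in the data
topologies `H^s_δ × H^{s-1}_{δ+1}` (`InitialDataSet.dataWeightedSobolevEDist`, convention of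
`WeightedNorms.lean`: weight `(1 + ‖y‖)^{2(δ+m)}` on `‖D^m(h − h₀)‖²`, larger `δ` = faster decay) with
`δ ≥ 0`. This file proves what such basins see (everything proved, no definitions, no named facts):

* Kerr–Schild algebra at a point with `r > 0`: the spatial part `ℓ⃗` of the null covector has unit
  Euclidean length (`nullCovector_ofTimeSpace_spatial_nullVector`, `norm_spatial_nullVector_sq`, from
  the tree's nullity `Kerr.nullCovector_nullVector`); the radius relations `z² ≤ r² ≤ ‖y‖²`,
  `‖y‖² − a² ≤ r²` (`radius_relations`, from `Kerr.radius_quartic`); hence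
  `r³/(r⁴ + a²z²) ≥ 1/(2‖y‖)` for `‖y‖ ≥ 2|a|` (`scalarH_coeff_ge`).
* `data_h_inner_apply` — `h_y(v, w) = g_{M,a}((0,v),(0,w))` for the Kerr data (general spin; the
  tree has the `a = 0` case `Kerr.data_h_inner_zero_apply`), so with `g = η + 2Hℓ⊗ℓ`,
  `H = M r³/(r⁴ + a²z²)` LINEAR in `M` and `ℓ` independent of `M`:
  `norm_hFun_sub_hFun_ge_kerr` — the metric components of `Kerr.data M a r₀` and `Kerr.data M' a r₀`
  differ at `y` (`‖y‖ ≥ 2|a|`) by at least `|M − M'|/‖y‖` in operator norm (test vector `ℓ⃗`).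
* `lintegral_eq_top_of_inv_sq_le` — `∫_{‖y‖ > R} ‖y‖⁻² dy = ∞` in `ℝ³` (dyadic annuli and the
  scaling of Lebesgue measure, `Measure.addHaar_closedBall`).
* `dataWeightedSobolevEDist_kerr_eq_top` — for `δ ≥ 0`, every `s`, every spin `a` and truncation
  radius `r₀`, two Kerr–Schild data sets of the same spin and different masses are at INFINITE
  distance; `kerr_not_mem_basin` — hence no `ε`-basin (any `ε`; in particular the `ε` of
  `BulkKerrCapture` and the `c·χ^γ` of `NearExtremalKappaCapture`) around `Kerr.data M a M` contains
  `Kerr.data M' a M` for `M' ≠ M`, however small `|M − M'|`.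

Reading (print level, not formalised): for `δ ≥ -1/2` the `m = 0` weight already makes every `O(1/r)`
discrepancy non-integrable, so membership in ANY basin around `Kerr.data M a M` pins the ADM
energy–momentum of the datum to that of the reference Kerr slice (Bartnik 1986, Thm 4.2) — while the
near field of a late Cauchy slice of a radiating development is close to Kerr with the smaller Bondi
mass. The capture hypotheses, as typed with `∃ δ`, can therefore not be applied by the front end to any
slice of a development that radiates a macroscopic amount of energy; the route's intended basins need
`δ < -1/2` (finite norm of `δM/r` tails), which only a FIXED `δ` in items 10606/10696 can express.
-/

-- the problem namespace `FinalStateConjecture.FinalStateConjecture` (single-conjunct summit) trips dupNamespace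
set_option linter.dupNamespace false

noncomputable section

open scoped Manifold ContDiff Topology ENNReal InnerProductSpace RealInnerProductSpace
open Set Filter MeasureTheory TopologicalSpace

namespace Summit.FinalStateConjecture.FinalStateConjecture.Theorems.CaptureSuffices.Negative

open Literature.Geometry.Lorentzian

/-- Divergence: on a set containing `{‖y‖ > R}` in `ℝ³`, a nonnegative function bounded below
by `κ / ‖y‖²` (`κ > 0`) has infinite Lebesgue integral (dyadic annuli each contribute
`≥ 7κ 2ⁿ R · |B₁| / 4`). -/
theorem lintegral_eq_top_of_inv_sq_le {κ R : ℝ} (hκ : 0 < κ) (hR : 0 < R) {U : Set E3}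
    (hU : {y : E3 | R < ‖y‖} ⊆ U) {f : E3 → ℝ≥0∞}
    (hf : ∀ y : E3, R < ‖y‖ → ENNReal.ofReal (κ / ‖y‖ ^ 2) ≤ f y) :
    ∫⁻ y in U, f y = ⊤ := by
  set b : ℝ≥0∞ := volume (Metric.ball (0 : E3) 1) with hb
  have hb0 : b ≠ 0 :=
    (Metric.isOpen_ball.measure_pos volume ⟨0, Metric.mem_ball_self one_pos⟩).ne'
  have hbtop : b ≠ ⊤ := measure_ball_lt_top.ne
  have key : ∀ n : ℕ, ENNReal.ofReal (κ * R) * b * n ≤ ∫⁻ y in U, f y := by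
    intro n
    set ρ : ℝ := 2 ^ n * R with hρ
    have h2n : (1 : ℝ) ≤ 2 ^ n := one_le_pow₀ (by norm_num)
    have hρR : R ≤ ρ := le_mul_of_one_le_left hR.le h2n
    have hρ0 : 0 < ρ := lt_of_lt_of_le hR hρR
    set A : Set E3 := Metric.closedBall 0 (2 * ρ) \ Metric.closedBall 0 ρ with hA
    have hAU : A ⊆ U := by
      intro y hy
      apply hU
      have hy2 : ρ < ‖y‖ := lt_of_not_ge fun h ↦ hy.2 (mem_closedBall_zero_iff.2 h)
      exact lt_of_le_of_lt hρR hy2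
    have hAm : MeasurableSet A := measurableSet_closedBall.diff measurableSet_closedBall
    have hfA : ∀ y ∈ A, ENNReal.ofReal (κ / (2 * ρ) ^ 2) ≤ f y := by
      intro y hy
      have hy1 : ‖y‖ ≤ 2 * ρ := mem_closedBall_zero_iff.1 hy.1
      have hy2 : ρ < ‖y‖ := lt_of_not_ge fun h ↦ hy.2 (mem_closedBall_zero_iff.2 h)
      refine le_trans (ENNReal.ofReal_le_ofReal ?_) (hf y (lt_of_le_of_lt hρR hy2))
      exact div_le_div_of_nonneg_left hκ.le (pow_pos (hρ0.trans hy2) 2)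
        (pow_le_pow_left₀ (norm_nonneg _) hy1 2)
    have hvol : ENNReal.ofReal (7 * ρ ^ 3) * b ≤ volume A := by
      have h1 : volume (Metric.closedBall (0 : E3) (2 * ρ)) = ENNReal.ofReal ((2 * ρ) ^ 3) * b := by
        rw [Measure.addHaar_closedBall volume (0 : E3) (by positivity : (0 : ℝ) ≤ 2 * ρ),
          finrank_euclideanSpace_fin]
      have h2 : volume (Metric.closedBall (0 : E3) ρ) = ENNReal.ofReal (ρ ^ 3) * b := by
        rw [Measure.addHaar_closedBall volume (0 : E3) hρ0.le, finrank_euclideanSpace_fin]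
      calc ENNReal.ofReal (7 * ρ ^ 3) * b
          = ENNReal.ofReal ((2 * ρ) ^ 3 - ρ ^ 3) * b := by congr 1; ring_nf
        _ = (ENNReal.ofReal ((2 * ρ) ^ 3) - ENNReal.ofReal (ρ ^ 3)) * b := by
            rw [ENNReal.ofReal_sub _ (by positivity)]
        _ = ENNReal.ofReal ((2 * ρ) ^ 3) * b - ENNReal.ofReal (ρ ^ 3) * b := by
            rw [ENNReal.sub_mul fun _ _ ↦ hbtop]
        _ = volume (Metric.closedBall (0 : E3) (2 * ρ)) - volume (Metric.closedBall (0 : E3) ρ) := by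
            rw [h1, h2]
        _ ≤ volume A := le_measure_sdiff
    have hn : (n : ℝ) ≤ 2 ^ n := by exact_mod_cast (Nat.lt_pow_self (by norm_num : 1 < 2)).le
    have harith : ENNReal.ofReal (κ * R) * b * n ≤
        ENNReal.ofReal (κ / (2 * ρ) ^ 2) * (ENNReal.ofReal (7 * ρ ^ 3) * b) := by
      have e1 : ENNReal.ofReal (κ * R * n) * b = ENNReal.ofReal (κ * R) * b * n := by
        rw [ENNReal.ofReal_mul (p := κ * R) (by positivity), ENNReal.ofReal_natCast]; ring
      have e2 : ENNReal.ofReal (κ / (2 * ρ) ^ 2 * (7 * ρ ^ 3)) * b =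
          ENNReal.ofReal (κ / (2 * ρ) ^ 2) * (ENNReal.ofReal (7 * ρ ^ 3) * b) := by
        rw [ENNReal.ofReal_mul (p := κ / (2 * ρ) ^ 2) (by positivity)]; ring
      rw [← e1, ← e2]
      refine mul_le_mul' (ENNReal.ofReal_le_ofReal ?_) le_rfl
      have : κ / (2 * ρ) ^ 2 * (7 * ρ ^ 3) = 7 / 4 * κ * ρ := by
        field_simp; ring
      rw [this, hρ]
      have hκR : 0 ≤ κ * R := by positivity
      nlinarith
    calc ENNReal.ofReal (κ * R) * b * n
        ≤ ENNReal.ofReal (κ / (2 * ρ) ^ 2) * (ENNReal.ofReal (7 * ρ ^ 3) * b) := harith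
      _ ≤ ENNReal.ofReal (κ / (2 * ρ) ^ 2) * volume A := mul_le_mul' le_rfl hvol
      _ = ∫⁻ _ in A, ENNReal.ofReal (κ / (2 * ρ) ^ 2) := (setLIntegral_const A _).symm
      _ ≤ ∫⁻ y in A, f y := setLIntegral_mono' hAm hfA
      _ ≤ ∫⁻ y in U, f y := lintegral_mono_set hAU
  have hc : ENNReal.ofReal (κ * R) * b ≠ 0 := by
    refine mul_ne_zero ?_ hb0
    rw [ne_eq, ENNReal.ofReal_eq_zero, not_le]
    positivity
  have : ENNReal.ofReal (κ * R) * b * ⊤ ≤ ∫⁻ y in U, f y := by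
    rw [← ENNReal.iSup_natCast, ENNReal.mul_iSup]
    exact iSup_le key
  rwa [ENNReal.mul_top hc, top_le_iff] at this


/-! ### Kerr–Schild algebra at a point `x` with `r = radius a x > 0` -/

/-- The spatial part `ℓ⃗ = (ℓ₁, ℓ₂, ℓ₃)` of the Kerr–Schild null (co)vector has Euclidean norm
`1`: `ℓ(ℓ♯) = −ℓ₀² + |ℓ⃗|² = 0` with `ℓ₀ = 1`. Stated as: `ℓ` evaluated on the tangent vector
`(0, ℓ⃗)` of the slice is `1`. -/
theorem nullCovector_ofTimeSpace_spatial_nullVector {a : ℝ} {x : E4} (hx : 0 < Kerr.radius a x) :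
    Kerr.nullCovector a x (E4.ofTimeSpace 0 (E4.spatial (Kerr.nullVector a x))) = 1 := by
  have h0 := Kerr.nullCovector_nullVector hx
  rw [Kerr.nullCovector, E4.covector_apply, Fin.sum_univ_four] at h0 ⊢
  have e0 : Kerr.nullCovectorFun a x 0 = 1 := rfl
  have c0 : (E4.ofTimeSpace 0 (E4.spatial (Kerr.nullVector a x))) 0 = 0 := rfl
  have c1 : (E4.ofTimeSpace 0 (E4.spatial (Kerr.nullVector a x))) 1 = Kerr.nullVector a x 1 := rfl
  have c2 : (E4.ofTimeSpace 0 (E4.spatial (Kerr.nullVector a x))) 2 = Kerr.nullVector a x 2 := rfl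
  have c3 : (E4.ofTimeSpace 0 (E4.spatial (Kerr.nullVector a x))) 3 = Kerr.nullVector a x 3 := rfl
  have n0 : Kerr.nullVector a x 0 = - Kerr.nullCovectorFun a x 0 := rfl
  have n1 : Kerr.nullVector a x 1 = Kerr.nullCovectorFun a x 1 := rfl
  have n2 : Kerr.nullVector a x 2 = Kerr.nullCovectorFun a x 2 := rfl
  have n3 : Kerr.nullVector a x 3 = Kerr.nullCovectorFun a x 3 := rfl
  rw [c0, c1, c2, c3, n1, n2, n3]
  rw [n0, n1, n2, n3, e0] at h0
  rw [e0]
  linarith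

/-- `|ℓ⃗|² = 1` as a statement about the Euclidean norm of `E3`. -/
theorem norm_spatial_nullVector_sq {a : ℝ} {x : E4} (hx : 0 < Kerr.radius a x) :
    ‖E4.spatial (Kerr.nullVector a x)‖ ^ 2 = 1 := by
  have h1 := nullCovector_ofTimeSpace_spatial_nullVector hx
  rw [Kerr.nullCovector, E4.covector_apply, Fin.sum_univ_four] at h1
  have c0 : (E4.ofTimeSpace 0 (E4.spatial (Kerr.nullVector a x))) 0 = 0 := rfl
  have c1 : (E4.ofTimeSpace 0 (E4.spatial (Kerr.nullVector a x))) 1 = Kerr.nullVector a x 1 := rfl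
  have c2 : (E4.ofTimeSpace 0 (E4.spatial (Kerr.nullVector a x))) 2 = Kerr.nullVector a x 2 := rfl
  have c3 : (E4.ofTimeSpace 0 (E4.spatial (Kerr.nullVector a x))) 3 = Kerr.nullVector a x 3 := rfl
  have n1 : Kerr.nullVector a x 1 = Kerr.nullCovectorFun a x 1 := rfl
  have n2 : Kerr.nullVector a x 2 = Kerr.nullCovectorFun a x 2 := rfl
  have n3 : Kerr.nullVector a x 3 = Kerr.nullCovectorFun a x 3 := rfl
  rw [c0, c1, c2, c3, n1, n2, n3] at h1
  rw [PiLp.norm_sq_eq_of_L2, Fin.sum_univ_three]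
  simp only [Real.norm_eq_abs, sq_abs, E4.spatial_apply]
  have s1 : Kerr.nullVector a x (Fin.succ 0) = Kerr.nullCovectorFun a x 1 := rfl
  have s2 : Kerr.nullVector a x (Fin.succ 1) = Kerr.nullCovectorFun a x 2 := rfl
  have s3 : Kerr.nullVector a x (Fin.succ 2) = Kerr.nullCovectorFun a x 3 := rfl
  rw [s1, s2, s3]
  nlinarith

/-- Kerr–Schild radius relations at `x = (0, y)`: `z² ≤ r²`, `r² ≤ ‖y‖²`, `‖y‖² − a² ≤ r²`. -/
theorem radius_relations (a : ℝ) (y : E3) (hr : 0 < Kerr.radius a (E4.ofTimeSpace 0 y)) :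
    (y 2) ^ 2 ≤ Kerr.radius a (E4.ofTimeSpace 0 y) ^ 2 ∧
      Kerr.radius a (E4.ofTimeSpace 0 y) ^ 2 ≤ ‖y‖ ^ 2 ∧
      ‖y‖ ^ 2 - a ^ 2 ≤ Kerr.radius a (E4.ofTimeSpace 0 y) ^ 2 := by
  set x := E4.ofTimeSpace 0 y with hxdef
  set r := Kerr.radius a x with hrdef
  have hq := Kerr.radius_quartic a x
  have hsq := Kerr.radius_sq a x
  have habs := Kerr.abs_le_sqrt_radius_discr a x
  rw [← hrdef] at hq hsq
  have hn : E4.spatialNorm x = ‖y‖ := E4.spatialNorm_ofTimeSpace 0 y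
  rw [hn] at hq hsq habs
  have hx3 : x 3 = y 2 := rfl
  rw [hx3] at hq habs hsq
  have hy : ‖y‖ ^ 2 = y 0 ^ 2 + y 1 ^ 2 + y 2 ^ 2 := by
    rw [PiLp.norm_sq_eq_of_L2, Fin.sum_univ_three]
    simp only [Real.norm_eq_abs, sq_abs]
  have hr2 : 0 < r ^ 2 := by positivity
  -- (r² − z²)(r² + a²) = r² (y₀² + y₁²) ≥ 0
  have key : (r ^ 2 - y 2 ^ 2) * (r ^ 2 + a ^ 2) = r ^ 2 * (y 0 ^ 2 + y 1 ^ 2) := by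
    have : r ^ 4 = (‖y‖ ^ 2 - a ^ 2) * r ^ 2 + a ^ 2 * y 2 ^ 2 := by linarith
    nlinarith
  have h1 : y 2 ^ 2 ≤ r ^ 2 := by
    by_contra hcon
    push Not at hcon
    have : (r ^ 2 - y 2 ^ 2) * (r ^ 2 + a ^ 2) < 0 :=
      mul_neg_of_neg_of_pos (by linarith) (by positivity)
    nlinarith [sq_nonneg (y 0), sq_nonneg (y 1)]
  refine ⟨h1, ?_, ?_⟩
  · have : r ^ 4 ≤ (‖y‖ ^ 2 - a ^ 2) * r ^ 2 + a ^ 2 * r ^ 2 := by nlinarith [sq_nonneg a]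
    have h4 : r ^ 4 = r ^ 2 * r ^ 2 := by ring
    nlinarith
  · nlinarith [le_abs_self (‖y‖ ^ 2 - a ^ 2)]

/-- The lower bound `r³/(r⁴ + a² z²) ≥ 1/(2‖y‖)` at `x = (0, y)` for `‖y‖ ≥ 2|a|`, `r > 0`
(`z² ≤ r²` and `3a² ≤ r²` give `r⁴ + a²z² ≤ (4/3) r⁴`, and `r ≤ ‖y‖`). -/
theorem scalarH_coeff_ge (a : ℝ) (y : E3) (hr : 0 < Kerr.radius a (E4.ofTimeSpace 0 y))
    (hya : 2 * |a| ≤ ‖y‖) :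
    1 / (2 * ‖y‖) ≤ Kerr.radius a (E4.ofTimeSpace 0 y) ^ 3 /
      (Kerr.radius a (E4.ofTimeSpace 0 y) ^ 4 + a ^ 2 * (E4.ofTimeSpace 0 y 3) ^ 2) := by
  obtain ⟨h1, h2, h3⟩ := radius_relations a y hr
  set r := Kerr.radius a (E4.ofTimeSpace 0 y) with hrdef
  have hx3 : E4.ofTimeSpace 0 y 3 = y 2 := rfl
  rw [hx3]
  have ha2 : 4 * a ^ 2 ≤ ‖y‖ ^ 2 := by
    have : (2 * |a|) ^ 2 ≤ ‖y‖ ^ 2 := pow_le_pow_left₀ (by positivity) hya 2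
    nlinarith [sq_abs a]
  have hra : 3 * a ^ 2 ≤ r ^ 2 := by linarith
  have hy0 : 0 < ‖y‖ := by nlinarith [norm_nonneg y]
  have hrle : r ≤ ‖y‖ := by nlinarith [norm_nonneg y]
  have e1 : a ^ 2 * y 2 ^ 2 ≤ a ^ 2 * r ^ 2 := mul_le_mul_of_nonneg_left h1 (sq_nonneg a)
  have e2 : 3 * (a ^ 2 * r ^ 2) ≤ r ^ 2 * r ^ 2 := by nlinarith [sq_nonneg r]
  have e3 : r ^ 4 ≤ r ^ 3 * ‖y‖ := by
    have : r ^ 4 = r ^ 3 * r := by ring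
    rw [this]
    exact mul_le_mul_of_nonneg_left hrle (by positivity)
  rw [div_le_div_iff₀ (by positivity) (by positivity)]
  nlinarith

/-- The metric of the Kerr data on tangent vectors of the slice (general spin):
`h_y(v, w) = g_{M,a}((0, v), (0, w))` at `(0, y)`. -/
theorem data_h_inner_apply [Kerr.Facts] [Kerr.SliceFacts] (M a r₀ : ℝ) (hM : 0 ≤ M)
    (y : Kerr.slice a r₀) (v w : E3) :
    (Kerr.data M a r₀ hM).h.inner y v w =
      Kerr.bilin M a (E4.ofTimeSpace 0 y) (E4.ofTimeSpace 0 v) (E4.ofTimeSpace 0 w) := by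
  rw [Kerr.data_h_inner, PseudoRiemannianMetric.inducedBilin_apply, Kerr.smoothMetric_val,
    Kerr.mfderiv_sliceEmbed_apply, Kerr.mfderiv_sliceEmbed_apply, Kerr.coe_sliceEmbed]
  rfl

/-- Pointwise (general spin): the metric components of two Kerr–Schild data sets with the same
spin `a` and different masses differ at `y`, `‖y‖ ≥ 2|a|`, by at least `|M − M'| / ‖y‖` in
operator norm (test on `v = w = ℓ⃗(0, y)`: `(h_M − h_{M'})(ℓ⃗, ℓ⃗) = 2(M − M') r³/(r⁴ + a²z²)`,
`ℓ⃗` being independent of `M` and of unit length). -/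
theorem norm_hFun_sub_hFun_ge_kerr [Kerr.Facts] [Kerr.SliceFacts] {M M' : ℝ} (hM : 0 ≤ M)
    (hM' : 0 ≤ M') {a r₀ : ℝ} {y : E3} (hy : y ∈ Kerr.slice a r₀) (hya : 2 * |a| ≤ ‖y‖) :
    |M - M'| / ‖y‖ ≤ ‖(Kerr.data M a r₀ hM).hFun y - (Kerr.data M' a r₀ hM').hFun y‖ := by
  set x := E4.ofTimeSpace 0 y with hxdef
  have hr : 0 < Kerr.radius a x := lt_of_le_of_lt (le_max_right _ _) (Kerr.mem_slice.1 hy)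
  obtain ⟨-, h2, -⟩ := radius_relations a y hr
  have hy0 : 0 < ‖y‖ := by nlinarith [norm_nonneg y]
  set v : E3 := E4.spatial (Kerr.nullVector a x) with hvdef
  have hv1 : ‖v‖ = 1 := by
    have h := norm_spatial_nullVector_sq hr
    rw [← hvdef] at h
    nlinarith [norm_nonneg v]
  have hℓ : Kerr.nullCovector a x (E4.ofTimeSpace 0 v) = 1 :=
    nullCovector_ofTimeSpace_spatial_nullVector hr
  set B := (Kerr.data M a r₀ hM).hFun y - (Kerr.data M' a r₀ hM').hFun y with hBdef
  set q : ℝ := Kerr.radius a x ^ 3 / (Kerr.radius a x ^ 4 + a ^ 2 * (x 3) ^ 2) with hqdef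
  have e1 : (Kerr.data M a r₀ hM).hFun y v v =
      Minkowski.bilin (E4.ofTimeSpace 0 v) (E4.ofTimeSpace 0 v) + 2 * Kerr.scalarH M a x := by
    rw [InitialDataSet.hFun_of_mem _ hy]
    have := data_h_inner_apply M a r₀ hM ⟨y, hy⟩ v v
    rw [Kerr.bilin_apply] at this
    rw [← hxdef, hℓ, mul_one, mul_one] at this
    exact this
  have e2 : (Kerr.data M' a r₀ hM').hFun y v v =
      Minkowski.bilin (E4.ofTimeSpace 0 v) (E4.ofTimeSpace 0 v) + 2 * Kerr.scalarH M' a x := by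
    rw [InitialDataSet.hFun_of_mem _ hy]
    have := data_h_inner_apply M' a r₀ hM' ⟨y, hy⟩ v v
    rw [Kerr.bilin_apply] at this
    rw [← hxdef, hℓ, mul_one, mul_one] at this
    exact this
  have hH : Kerr.scalarH M a x - Kerr.scalarH M' a x = (M - M') * q := by
    rw [hqdef, Kerr.scalarH, Kerr.scalarH]
    ring
  have hB : B v v = 2 * (M - M') * q := by
    have : B v v = (Kerr.data M a r₀ hM).hFun y v v - (Kerr.data M' a r₀ hM').hFun y v v := by
      rw [hBdef]; rfl
    rw [this, e1, e2]
    linear_combination 2 * hH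
  have h := ContinuousLinearMap.le_opNorm₂ B v v
  rw [Real.norm_eq_abs, hB, hv1, mul_one, mul_one] at h
  have hq : 1 / (2 * ‖y‖) ≤ q := scalarH_coeff_ge a y hr hya
  have hq0 : 0 ≤ q := le_trans (by positivity) hq
  have habs : |2 * (M - M') * q| = 2 * |M - M'| * q := by
    rw [abs_mul, abs_mul, abs_of_nonneg hq0, abs_of_pos (by norm_num : (0 : ℝ) < 2)]
  rw [habs] at h
  calc |M - M'| / ‖y‖ = 2 * |M - M'| * (1 / (2 * ‖y‖)) := by field_simp
    _ ≤ 2 * |M - M'| * q := mul_le_mul_of_nonneg_left hq (by positivity)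
    _ ≤ ‖B‖ := h

/-- **Mass pinning, general spin.** For `δ ≥ 0`, every `s`, every spin `a` and truncation `r₀`,
two Kerr–Schild data sets `Kerr.data M a r₀`, `Kerr.data M' a r₀` with `M ≠ M'` are at INFINITE
`H^s_δ × H^{s-1}_{δ+1}` distance (so the near-extremal basins of `NearExtremalKappaCapture`, read at
`δ ≥ 0` WLOG, pin the mass exactly as the bulk ones do). -/
theorem dataWeightedSobolevEDist_kerr_eq_top [Kerr.Facts] [Kerr.SliceFacts] {M M' : ℝ}
    (hM : 0 ≤ M) (hM' : 0 ≤ M') (hne : M ≠ M') (a r₀ : ℝ) (s : ℕ) {δ : ℝ} (hδ : 0 ≤ δ) :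
    InitialDataSet.dataWeightedSobolevEDist s δ (Kerr.data M a r₀ hM) (Kerr.data M' a r₀ hM') = ⊤ := by
  set g := (Kerr.data M a r₀ hM).hFun - (Kerr.data M' a r₀ hM').hFun with hg
  have hMM : 0 < (M - M') ^ 2 := by
    have : M - M' ≠ 0 := sub_ne_zero.2 hne
    positivity
  have hR : 0 < Kerr.afRadius a r₀ + 2 * |a| := by
    have := Kerr.afRadius_pos a r₀; positivity
  have hdiv : ∫⁻ x in (Kerr.slice a r₀ : Set E3), ENNReal.ofReal
      ((1 + ‖x‖) ^ (2 * (δ + ((0 : ℕ) : ℝ)) : ℝ) * ‖iteratedFDeriv ℝ 0 g x‖ ^ 2) = ⊤ := by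
    refine lintegral_eq_top_of_inv_sq_le hMM hR (fun y hy ↦ Kerr.mem_slice_of_lt_norm ?_)
      fun y hy ↦ ?_
    · have : 0 ≤ 2 * |a| := by positivity
      exact lt_of_le_of_lt (by linarith) hy
    have hya : 2 * |a| ≤ ‖y‖ := by linarith [(Kerr.afRadius_pos a r₀).le]
    have hyU : y ∈ Kerr.slice a r₀ :=
      Kerr.mem_slice_of_lt_norm (lt_of_le_of_lt (by linarith [abs_nonneg a]) hy)
    have hy0 : 0 < ‖y‖ := hR.trans hy
    rw [norm_iteratedFDeriv_zero]
    refine ENNReal.ofReal_le_ofReal ?_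
    have h1 : 1 ≤ (1 + ‖y‖) ^ (2 * (δ + ((0 : ℕ) : ℝ)) : ℝ) :=
      Real.one_le_rpow (by linarith [norm_nonneg y]) (by push_cast; linarith)
    have h2 : |M - M'| / ‖y‖ ≤ ‖g y‖ := by
      rw [hg, Pi.sub_apply]
      exact norm_hFun_sub_hFun_ge_kerr hM hM' hyU hya
    have h3 : (M - M') ^ 2 / ‖y‖ ^ 2 = (|M - M'| / ‖y‖) ^ 2 := by
      rw [div_pow, sq_abs]
    rw [h3]
    calc (|M - M'| / ‖y‖) ^ 2 ≤ ‖g y‖ ^ 2 := pow_le_pow_left₀ (by positivity) h2 2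
      _ = 1 * ‖g y‖ ^ 2 := (one_mul _).symm
      _ ≤ (1 + ‖y‖) ^ (2 * (δ + ((0 : ℕ) : ℝ)) : ℝ) * ‖g y‖ ^ 2 :=
          mul_le_mul_of_nonneg_right h1 (sq_nonneg _)
  have hsemi : weightedSobolevSeminorm (Kerr.slice a r₀ : Set E3) s δ g = ⊤ := by
    unfold weightedSobolevSeminorm
    have hsum : ∑ m ∈ Finset.range (s + 1), ∫⁻ x in (Kerr.slice a r₀ : Set E3), ENNReal.ofReal
        ((1 + ‖x‖) ^ (2 * (δ + m) : ℝ) * ‖iteratedFDeriv ℝ m g x‖ ^ 2) = ⊤ := by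
      refine eq_top_iff.2 (le_trans (le_of_eq hdiv.symm) ?_)
      exact Finset.single_le_sum (f := fun m : ℕ ↦ ∫⁻ x in (Kerr.slice a r₀ : Set E3), ENNReal.ofReal
        ((1 + ‖x‖) ^ (2 * (δ + m) : ℝ) * ‖iteratedFDeriv ℝ m g x‖ ^ 2)) (fun _ _ ↦ zero_le)
        (Finset.mem_range.2 (Nat.succ_pos s))
    rw [hsum]
    exact ENNReal.top_rpow_of_pos (by norm_num)
  unfold InitialDataSet.dataWeightedSobolevEDist
  rw [← hg, hsemi, top_add]


/-- **No basin around Kerr data contains Kerr data of another mass** (same spin, `δ ≥ 0`): the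
shape in which the capture items use the distance (`dist D (Kerr.data M a r₀ _) < ofReal ε`). -/
theorem kerr_not_mem_basin [Kerr.Facts] [Kerr.SliceFacts] {M M' : ℝ} (hM : 0 ≤ M) (hM' : 0 ≤ M')
    (hne : M' ≠ M) (a r₀ : ℝ) (s : ℕ) {δ : ℝ} (hδ : 0 ≤ δ) (ε : ℝ) :
    ¬ InitialDataSet.dataWeightedSobolevEDist s δ (Kerr.data M' a r₀ hM') (Kerr.data M a r₀ hM) <
      ENNReal.ofReal ε := by
  rw [dataWeightedSobolevEDist_kerr_eq_top hM' hM hne a r₀ s hδ]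
  exact not_lt_of_ge le_top

end Summit.FinalStateConjecture.FinalStateConjecture.Theorems.CaptureSuffices.Negative
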